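import Literature.MathematicalPhysics.QuantumManyBody.LiebSimpleEquationProofs
import Mathlib.Analysis.SpecialFunctions.Gaussian.FourierTransform
import Mathlib.MeasureTheory.Group.Measure
import Mathlib.MeasureTheory.Function.L2Space
import HarnessLib

/-!
# Lieb's simple equation (Carlen–Jauslin–Lieb): the theorems of CJL-I/II as named facts

Topic: `Literature/MathematicalPhysics/QuantumManyBody`. Companion of `LiebSimpleEquation.lean`
(the objects: `IsSolution`, `densityFn`, `energyFn`, `IsPinnedSolution`, `pinnedEnergy`, `eta`,
`keApply`, `etaFormula`, `IsScatteringSolution`, `scatteringLengthOf`), answering the second half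
of definition request `defn-LiebSimpleEquation` (route AtomisticToContinuum/BoseEinsteinCondensation/
BECAmplitudeHierarchy, crux `HierarchyContraction`): "named facts wanted alongside as `def … : Prop`
with cite tags (to be consumed as hypotheses): CJL-I Thm 1, Thm 2; CJL-II Thm 2, Thm 3, Thm 6".
CJL-I = Carlen–Jauslin–Lieb, Pure Appl. Anal. 2 (2020), arXiv:1912.04987; CJL-II = SIAM J. Math.
Anal. 53 (2021), arXiv:2010.13882. Units of CJL throughout (`m = ħ = 1`, `−½Δ` per particle; see
`halfProfile` in the objects file for the map to the tree's `ħ = 2m = 1` Bose gas).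

## Contents

* `IsWeightedPotential v` — the standing hypothesis of CJL-II: `v ≥ 0` radial on `ℝ³` with
  `(1 + |x|⁴)v ∈ L¹ ∩ L²` (CJL-II §1, first paragraph); `eStar v = e⋆ := √2 π³/‖v‖₁²` and
  `eHigh v = 2³‖v‖₂⁴/π⁴`, the printed thresholds of CJL-II Thm 3; `decayBeta`, `decayCoeff`,
  `decayRemainder` — the `β`, `√(2+β)/(2π²√e)` and `R` of CJL-II Thm 2.
* Named facts (statements as printed, specialised to `d = 3` = the tree's `BoseGas.Space`):
  `CarlenJauslinLieb2020_thm1` (existence/uniqueness and the density function `ρ(e)`; DISCHARGED: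
  `CarlenJauslinLieb2020_thm1_holds`, `LiebSimpleEquationExistence.lean`),
  `CarlenJauslinLieb2020_thm2` (for each `ρ` an `e`; `e = 2πρa(1 + 128/(15√π)√(ρa³) + o(√ρ))`;
  `e = (ρ/2)∫𝒱 + o(ρ)`; DISCHARGED: `CarlenJauslinLieb2020_thm2_holds`,
  `LiebSimpleEquationLowDensity.lean`). CJL-II Thm 6 (condensate fraction) is the named fact
  `CarlenJauslinLieb2021_thm6_rightDeriv` of the sibling file `LiebSimpleEquationCondensateFraction.lean`
  (which imports this one): the corrected rendering (along a pinned branch `μ ≥ 0` through a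
  solution triple, the right derivative `∂_μ e_μ|_{μ=0⁺}` of an `L²`-differentiable branch equals the
  closed formula (1.25) `etaFormula`; `etaFormula ∼ 8√(ρa³)/(3√π)` as `ρ → 0`), designed and
  recorded, docstring and statement in Lean, in §"CJL-II Theorem 6: the corrected rendering" below
  and vendored there verbatim (cite item `wi-24851`, 2026-08-15). Its first rendering
  `CarlenJauslinLieb2021_thm6` went through the tree's two-sided `eta`, which is identically `0`
  (`eta_eq_zero`, `LiebSimpleEquationPinned.lean`), so that it contradicts
  `CarlenJauslinLieb2020_thm1` (`not_CarlenJauslinLieb2021_thm6_of_thm1`, same file) and is refuted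
  outright (`not_CarlenJauslinLieb2021_thm6`, `LiebSimpleEquationFactsRefuted.lean`); it is RETIRED
  from this file (verdict clean-up 2026-08-15, see the section of that name below: MIS-RENDERED,
  hence refuted; those two theorems state the retired rendering verbatim in their types, as for
  Theorems 2 and 3). Two printed theorems are NOT named facts because they are
  MISSTATED IN PRINT (false as printed; D-0014: a false `Prop` is not offered as a hypothesis):
  CJL-II Thm 2 (decay `ρu = √(2+β)/(2π²√e)|x|⁻⁴ + R`, `|x|⁴R ∈ L² ∩ L^∞`, `u ≤ C/(ρ√e|x|⁴)`; the
  printed `β` is three times the `β` of its proof) — see the next bullet, §Erratum (Theorem 2)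
  below and `LiebSimpleEquationDecayErratum.lean` / `LiebSimpleEquationFactsRefuted.lean`, whose
  `not_CarlenJauslinLieb2021_thm2_of_thm1` / `not_CarlenJauslinLieb2021_thm2` state the printed
  theorem verbatim in their types and prove its negation (from `CarlenJauslinLieb2020_thm1`, resp.
  outright) — and CJL-II Thm 3 (monotonicity of `ρ(e)` below `e⋆` and above `2³‖v‖₂⁴/π⁴`,
  `ρ′ ≤ 16/‖v‖₁`) — see §Erratum (Theorem 3) below and `LiebSimpleEquationErratum.lean` /
  `LiebSimpleEquationDensityBounds.lean`, whose `not_CarlenJauslinLieb2021_thm3` /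
  `not_CarlenJauslinLieb2021_thm3_unconditional` state the printed theorem verbatim and prove its
  negation (from `CarlenJauslinLieb2020_thm1 ∧ CarlenJauslinLieb2020_thm2`, resp. outright).
* CJL-II Theorem 2, statement versus proof (`decayBeta`, `decayCoeff`, `decayRemainder` render the
  printed `β`, `√(2+β)/(2π²√e)`, `R`; `correctedDecayCoeff`, `correctedDecayRemainder` the
  established ones; section "the printed versus the established tail" below): the printed
  definition (betadef) `β = ρ∫|x|²v(1 − u)` is three times the `β = −(ρ/4e)∂²_κŜ(0)` that the
  proof (§2) uses and the tail requires, because for the radial `S = v(1 − u)` the second-order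
  Taylor coefficient of `Ŝ` is `−(1/6)∫|x|²S`, not `−(1/2)∫|x|²S` (proved:
  `integral_inner_sq_mul_eq_of_radial`, `∫(k·x)²f = (|k|²/3)∫|x|²f` for radial `f` on `ℝ³`); the
  established tail coefficient is `√(2 + β/3)/(2π²√e)`.
  With the printed coefficient the `L²` assertion on `|x|⁴R` fails for every solution triple
  (proved here: `IsSolution.decayBeta_pos`, `eq_of_memLp_two_tail`,
  `IsSolution.not_memLp_two_decayRemainder_and` — the printed and the established `L²` clauses
  exclude each other; and, assuming nothing about the corrected clause, the sibling file
  `LiebSimpleEquationDecayErratum.lean` computes the tail constant from the equation: any `c'` with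
  `|x|⁴(ρu − c'|x|⁻⁴) ∈ L²` for an even solution triple equals `correctedDecayCoeff`
  (`IsSolution.eq_correctedDecayCoeff_of_memLp_two`), whence
  `not_CarlenJauslinLieb2021_thm2_of_thm1` and, with `CarlenJauslinLieb2020_thm1_holds`, the
  unconditional `not_CarlenJauslinLieb2021_thm2` of `LiebSimpleEquationFactsRefuted.lean`),
  while `β ≤ ρ‖x²v‖₁` (proved outright: `IsSolution.decayBeta_le`,
  `CarlenJauslinLieb2021_thm2_betaBound`), `|x|⁴R ∈ L^∞` (`memLp_top_decayRemainder_iff`) and the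
  pointwise bound are unaffected. History: the printed theorem was first vendored here verbatim as
  the named fact `CarlenJauslinLieb2021_thm2` (requested by `defn-LiebSimpleEquation`); once
  refuted it was RETIRED from this file (as Theorem 3 before it); the printed text is recorded in
  §Erratum (Theorem 2) below and, in Lean, as the type of the refuting theorems; the corrected
  statement is recorded as text in the section "the printed versus the established tail" (not as
  a named fact: no consumer, and its proof is the whole of CJL-II §2). Non-vacuity of the standing
  hypotheses: `isWeightedPotential_expNegSqNorm`, `integral_expNegSqNorm_pos`.
* Proved consequences / API: `densityFn_eq_of_isSolution`, `existsUnique_isSolution_densityFn`,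
  `continuousOn_densityFn` (Theorem 1 pins the `sSup`-selection `densityFn` to CJL's `ρ(e)`).
  The printed two-line facts `∫Y_{4e} = (4e)⁻¹`, `∫u = 1/ρ` (CJL-I (1.6); CJL-II §1 (intu)) and
  `2e ≤ ρ∫𝒱` (the lower half of CJL-I (1.21)) are THEOREMS in `LiebSimpleEquationProofs.lean`
  (`integral_yukawa`, `IsSolution.integral_eq`, `IsSolution.two_mul_le`), not facts.

## Rendering decisions (read before using a fact as a hypothesis)

* `𝒱 ≢ 0`. CJL tacitly assume the potential is not a.e. zero (their (1.21),
  `2e/‖𝒱‖₁ ≤ ρ(e) ≤ 4e/‖𝒱‖₁`, divides by `‖𝒱‖₁`); for `𝒱 = 0` a.e. the energy constraint forces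
  `e = 0` and Theorem 1 as printed would fail. Every fact below therefore carries `0 < ∫𝒱`.
* "ρ = ρ(e)" is rendered by "a solution exists at `(ρ, e)`" (`IsSolution 𝒱 ρ e u`), which is
  Theorem 1's characterisation; statements about the function `ρ(·)` use the tree's `densityFn`,
  equal to CJL's `ρ(e)` for every `e > 0` under Theorem 1 (`densityFn_eq_of_isSolution`).
* Asymptotic statements "`as ρ → 0` for any such `ρ` and `e`" are rendered uniformly over all
  solution triples `(ρ, e, u)` with `ρ` small (equivalent to the sequential reading), with the
  `o(·)` written out as `∀ ε > 0 ∃ ρ₀ …`; `e = 2πρa(1 + c√(ρa³) + o(√ρ))` becomes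
  `|e − 2πρa(1 + c√(ρa³))| ≤ ε·2πρa·√ρ`, and `η ∼ X` becomes `|η − X| ≤ εX`.
* The scattering length `a` of CJL-I Thm 2 / CJL-II Thm 6 is `(4π)⁻¹∫𝒱(1 − φ)` for the scattering
  solution `φ` (CJL-I §3.2: the theorem is stated with this formula, their Lemma 3.1/remark); we
  quantify it as `∃ φ, IsScatteringSolution 𝒱 φ ∧ …` with `a := scatteringLengthOf 𝒱 φ` — exactly
  what CJL prove for their `φ = lim_{e→0} K_e𝒱` (uniqueness of `φ` is true but not vendored here).
* CJL-II Theorem 6 speaks of `η = ∂_μ e_μ|₀` ((eta) = (1.21)) for the energy `e_μ` of the pinned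
  system (simpleq_eta) = (1.20) at fixed density `ρ`, through "the" solution `(e, u)` at `μ = 0`
  (§5: "`e₀ = e`, and we write `u = u₀`"). Two facts about (1.20) shape the corrected rendering
  (§"CJL-II Theorem 6: the corrected rendering" below; vendored as
  `CarlenJauslinLieb2021_thm6_rightDeriv` in `LiebSimpleEquationCondensateFraction.lean`). First,
  the pinned system has NO solution in the physical
  class for `μ < 0` (`IsPinnedSolution.mu_nonneg`, `LiebSimpleEquationPinned.lean`: integrating the
  mild form gives `2eρX² − (4e + 2μ)X + 2e/ρ = 0` for `X = ∫u`, discriminant `4μ(4e + μ) < 0`), so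
  `∂_μ|₀` can only be a RIGHT derivative along a branch `μ ≥ 0` of pinned solutions. Second, the
  existence of that branch and its `μ`-differentiability are asserted in §5 ("One can show the
  existence of a solution … one can prove that `u_μ` is differentiable with respect to `μ` in the
  same way as in the proof of the differentiability of `ρ` with respect to `e` in Section 3. The
  details of these two proofs are left to the reader"), not proved. The corrected rendering
  therefore takes the branch `μ ↦ (e_μ, u_μ)`, `0 ≤ μ < μ₀`, through `(e, u)` and its
  differentiability at `0⁺` in `L²(ℝ³)` (the mode of Theorem 3, "`u(e,·)` is continuously
  differentiable in `L²(ℝ³)`", which §5 invokes "in the same way") as HYPOTHESES, and concludes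
  that `e_μ` has the right derivative
  (1.25) at `0`: `HasDerivWithinAt e_· (etaFormula v ρ e u) (Ici 0) 0` — the content of §5's
  derivation (differentiate (1.20) at `μ = 0`, `s = 𝔎_e(2ηρu∗u − 2u − 4ηu)`, `η = −(ρ/2)∫sv`,
  solve for `η`). The asymptotic clause is stated for the closed formula `etaFormula` over solution
  triples as `ρ → 0`, which is (eta_asym) as §5 proves it. No energy window is involved (no
  least-energy selection enters). HISTORY: the first rendering, `CarlenJauslinLieb2021_thm6`, used
  the tree's `eta 𝒱 ρ = deriv (μ ↦ pinnedEnergy 𝒱 ρ μ) 0`, a TWO-SIDED derivative of the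
  least-energy selection `pinnedEnergy`, in the window `0 < e < e⋆`; since `0 ≤ pinnedEnergy ≤ −μ/2`
  on `μ < 0`, that `eta` is identically `0` (`eta_eq_zero`, audit of 2026-08-15), the rendering
  contradicts `CarlenJauslinLieb2020_thm1` (`not_CarlenJauslinLieb2021_thm6_of_thm1`) and is
  refuted outright (`not_CarlenJauslinLieb2021_thm6`, `LiebSimpleEquationFactsRefuted.lean`). It was
  deprecated and then retired from this file (verdict clean-up 2026-08-15, below); those two
  theorems spell its statement out verbatim in their types.
* Not vendored: CJL-I Thm 3 (superseded by CJL-II Thm 2), CJL-II Thm 2 (decay — misstated in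
  print, §Erratum (Theorem 2) below; its corrected form is recorded as text only), CJL-II Thm 3
  (monotonicity — misstated in print, §Erratum (Theorem 3) below), CJL-II Thm 6 here (its
  corrected rendering is the named fact `CarlenJauslinLieb2021_thm6_rightDeriv` of the sibling file
  `LiebSimpleEquationCondensateFraction.lean`; the first rendering is retired, §Verdict clean-up
  below), Thm 5 (convexity for `e < e⋆`;
  its proof invokes the `ρ′` bound of Thm 3), Thm 7 (momentum distribution), Thm 8 (explicit
  solution; its printed values are cross-checked in `LiebSimpleEquationFactsRefuted.lean`).

## Erratum (Theorem 2): CJL-II Theorem 2 is misstated in print (hence not a named fact)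

CJL-II Theorem 2 as printed — "If `(1 + |x|⁴)v ∈ L¹(ℝ³) ∩ L²(ℝ³)`, then
`ρu(x) = √(2+β)/(2π²√e)·|x|⁻⁴ + R(x)` where `β = ρ∫|x|²v(1 − u)dx ≤ ρ‖x²v‖₁`, and where `|x|⁴R(x)`
is in `L²(ℝ³) ∩ L^∞(ℝ³)`, uniformly in `e` on all compact sets. Moreover, for every `ρ₀ > 0`,
there is a constant `C` that only depends on `ρ₀` such that for all `x`, for all `ρ < ρ₀`,
`u(x) ≤ min{1, C/(ρ e^{1/2}|x|⁴)}`" — is FALSE as printed, in its `L²` clause, for every solution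
triple: the printed (betadef) `β` is three times the `β = −(ρ/4e)∂²_κŜ(0)` of the proof (§2,
`κ = |k|/(2√e)`), see the bullet "CJL-II Theorem 2, statement versus proof" above and
`correctedDecayCoeff` below. The tree's rendering of the printed theorem (for solution triples
`(ρ, e, u)`, `ρ, e > 0`, of the simple equation with a CJL-II potential, `IsWeightedPotential`:
`v ≥ 0` radial, `v ≢ 0`; the pointwise bound in the division-free form `ρ√e|x|⁴u(x) ≤ C`, `u ≤ 1`
being part of `IsSolution`; the uniformity of the remainder norms in `e` not recorded) reads

```
∀ (v : Space → ℝ), IsWeightedPotential v → 0 < ∫ x, v x →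
  (∀ (ρ e : ℝ) (u : Space → ℝ), 0 < ρ → 0 < e → IsSolution v ρ e u →
    decayBeta v ρ u ≤ ρ * ∫ x, ‖x‖ ^ 2 * v x ∧
    MemLp (fun x => ‖x‖ ^ 4 * decayRemainder v ρ e u x) 2 ∧
    MemLp (fun x => ‖x‖ ^ 4 * decayRemainder v ρ e u x) ∞) ∧
  (∀ ρ₀ : ℝ, 0 < ρ₀ → ∃ C : ℝ,
    ∀ (ρ e : ℝ) (u : Space → ℝ), 0 < ρ → ρ < ρ₀ → 0 < e → IsSolution v ρ e u →
      ∀ x : Space, ρ * Real.sqrt e * ‖x‖ ^ 4 * u x ≤ C)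
```

and is the type negated, verbatim, by `not_CarlenJauslinLieb2021_thm2_of_thm1`
(`LiebSimpleEquationDecayErratum.lean`, from `CarlenJauslinLieb2020_thm1`: for `v = 𝟙_{|x| ≤ 1}`
Theorem 1 gives an even solution triple at `e = 1`, and any `L²` tail constant of an even
solution triple is `correctedDecayCoeff`, `IsSolution.eq_correctedDecayCoeff_of_memLp_two`) and by
`not_CarlenJauslinLieb2021_thm2` (`LiebSimpleEquationFactsRefuted.lean`, outright, using
`CarlenJauslinLieb2020_thm1_holds`; that file also certifies the paper's own cross-check, the
explicit solution of CJL-II Theorem 8/§10, which matches `√(2 + β/3)` identically and `√(2 + β)`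
only on the excluded line `2e = b²`). History: the printed statement was first vendored verbatim
here as the named fact `CarlenJauslinLieb2021_thm2` (requested by `defn-LiebSimpleEquation`);
once refuted it was RETIRED from this file (D-0014; the record of the printed text is the display
above and the type of the refuting theorems). The printed closed form of `β` is repeated in
[Jauslin2022, Thm 4.4] and [Jauslin2025, Lemma 6.8] (both defer to CJL-II §2 for the proof); no
published correction is known to the tree (searched 2026-08-15). What §2 of the source does
establish is Theorem 2 with the coefficient `√(2 + β/3)/(2π²√e)` — recorded as text in the
section "the printed versus the established tail" below (`correctedDecayRemainder`), not as a
named fact (no consumer in the tree; a definition seat can vendor it verbatim when one appears).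

## Erratum (Theorem 3): CJL-II Theorem 3 is misstated in print (hence not a named fact)

CJL-II Theorem 3 as printed — "For `e < e⋆ := √2π³/‖v‖₁²` and for `e > 2³‖v‖₂⁴/π⁴`, `ρ(e)` is
strictly monotone increasing in `e`, and in these intervals `ρ(e)` is continuously differentiable.
[…] Moreover, for `e < e⋆` we have `ρ′ = dρ/de ≤ 16/‖v‖₁`" — is FALSE as printed. The sibling
files state it verbatim (with `ρ(·) = densityFn v`, `eStar`, `eHigh` below, `e > 0`, `v ≢ 0`) and
PROVE its negation: `LiebSimpleEquationErratum.lean` from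
`CarlenJauslinLieb2020_thm1 ∧ CarlenJauslinLieb2020_thm2`
(`LiebSimpleEquation.not_CarlenJauslinLieb2021_thm3`; the false clause isolated in
`not_CarlenJauslinLieb2021_thm3_derivBound`) — the printed clause `ρ′ ≤ 16/‖v‖₁` on `(0,e⋆)`
forces, with `ρ(0⁺) = 0` (Thm 1) and `e ∼ 2πρ(e)a` (Thm 2), `‖v‖₁ ≤ 32πa` for every CJL-II
potential, which the square well `30·𝟙_{|x|<1}` (`a ≤ 1`, `‖v‖₁ = 40π`) violates — and
`LiebSimpleEquationDensityBounds.lean` outright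
(`LiebSimpleEquation.not_CarlenJauslinLieb2021_thm3_unconditional`, replacing the two uses of CJL-I
by elementary a priori density bounds for the square well). The defect in print is the upper half
`ρ ≤ 4e/‖v‖₁` of CJL-I (1.21), used three times in the proof of CJL-II Theorem 3 (only its lower
half `2e ≤ ρ‖v‖₁` is a theorem here, `IsSolution.two_mul_le`); see the erratum file's module
docstring for the details and for a secondary factor-2 slip behind `e⋆`. History: the printed
statement was first vendored verbatim here as the named fact `CarlenJauslinLieb2021_thm3`
(requested by `defn-LiebSimpleEquation`); once refuted it was RETIRED from this file (D-0014: a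
false `Prop` must not be offered as a hypothesis; the record of the printed text is the type of the
refuting theorems). What the printed argument does support, once repaired, is only QUALITATIVE:
`ρ(·)` is strictly increasing and `C¹` on some `(0,e₀(v))` and on some `(e₁(v),∞)` (thresholds
depending on `v` through `ρ(·)`, not through `‖v‖₁`, `‖v‖₂` alone), with `ρ′ ≤ 4ρ/e` on the
former. In Lean: `∀ v, IsWeightedPotential v → 0 < ∫v → (∃ e₀ > 0, StrictMonoOn (densityFn v)
(Ioo 0 e₀) ∧ ContDiffOn ℝ 1 (densityFn v) (Ioo 0 e₀)) ∧ (∃ e₁, StrictMonoOn (densityFn v)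
(Ioi (max 0 e₁)) ∧ ContDiffOn ℝ 1 (densityFn v) (Ioi (max 0 e₁)))` — recorded here as the
candidate corrected statement; it is not vendored as a named fact (no printed proof of it exists as
such; CJL-II Lemma 16, `e ↦ eρ(e)` strictly increasing on `(0,∞)`, is unaffected by the slip).

## Verdict clean-up (2026-08-15): CJL-II Theorem 6 — the first rendering is retired

The named fact `CarlenJauslinLieb2021_thm6` (the first rendering of CJL-II Theorem 6, requested by
`defn-LiebSimpleEquation`) was found undischargeable AS STATED by its prove seat — MIS-RENDERED by
the tree: its `η` is `eta v ρ = deriv (μ ↦ pinnedEnergy v ρ μ) 0`, a two-sided derivative, which is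
identically `0` (`eta_eq_zero`, `LiebSimpleEquationPinned.lean`; "Rendering decisions" above) — and
is REFUTED in the tree: `not_CarlenJauslinLieb2021_thm6_of_thm1` (`LiebSimpleEquationPinned.lean`,
from `CarlenJauslinLieb2020_thm1`) and, outright, `not_CarlenJauslinLieb2021_thm6`
(`LiebSimpleEquationFactsRefuted.lean`, with `CarlenJauslinLieb2020_thm1_holds`). Treatment
(REFUTED ⇒ retire, as for Theorems 2 and 3 before it; D-0014: a false `Prop` must not be offered as
a hypothesis, and no in-place change of meaning): after an interim deprecation the `def` is DELETED
from this file; the two refuting theorems keep their names and state the retired rendering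
VERBATIM IN THEIR TYPES (the deleted `def` unfolded to exactly this formula, so the retyped
statements are definitionally the old ones). For the record, the retired rendering — "Assume that
`(1 + |x|⁴)v ∈ L¹(ℝ³) ∩ L²(ℝ³)`. The non-condensed fraction `η` defined in (eta) satisfies
`η = ρ∫v𝔎_e u / (1 − ρ∫v𝔎_e(2u − ρu∗u))`. As `ρ → 0`, `η` goes to `0` asymptotically as
`η ∼ 8√(ρa₀³)/(3√π)` where `a₀` is the scattering length of `v`", with `η = eta v ρ` in the window
`0 < e < e⋆` and the asymptotics over solution triples — read

```
∀ (v : Space → ℝ), IsWeightedPotential v → 0 < ∫ x, v x →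
  (∀ (ρ e : ℝ) (u : Space → ℝ), 0 < ρ → 0 < e → e < eStar v → IsSolution v ρ e u →
    eta v ρ = etaFormula v ρ e u) ∧
  (∃ φ : Space → ℝ, IsScatteringSolution v φ ∧
    ∀ ε : ℝ, 0 < ε → ∃ ρ₀ : ℝ, 0 < ρ₀ ∧
      ∀ (ρ e : ℝ) (u : Space → ℝ), 0 < ρ → ρ < ρ₀ → 0 < e → IsSolution v ρ e u →
        |eta v ρ - 8 * Real.sqrt (ρ * scatteringLengthOf v φ ^ 3) / (3 * Real.sqrt Real.pi)|
          ≤ ε * (8 * Real.sqrt (ρ * scatteringLengthOf v φ ^ 3) / (3 * Real.sqrt Real.pi)))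
```

(with `eta ≡ 0` its first conjunct says `etaFormula = 0` below `e⋆` and its second forces `a₀ = 0`
at the small-density solution triples of CJL-I Theorem 1, while `a₀ > 0`,
`IsScatteringSolution.scatteringLengthOf_pos`). What was wrong is the rendering (the definition
`eta`), not the printed theorem, whose `∂_μ|₀` can only be a right derivative along a branch
`μ ≥ 0` of pinned solutions (`IsPinnedSolution.mu_nonneg`). The CORRECTED rendering is RESTATED
under the new name `CarlenJauslinLieb2021_thm6_rightDeriv`: designed and recorded in the next
section (docstring and statement in Lean) and vendored verbatim as a named fact in the sibling file
`LiebSimpleEquationCondensateFraction.lean`, which imports this one (cite item `wi-24851` of the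
route thesis `BECAmplitudeGas` of `Summits/AtomisticToContinuum/BoseEinsteinCondensation`,
2026-08-15; a verdict-clean-up unit may not itself add an unproved named fact, D-0026
`lint.fact-fanout`, and the fact's proof — the whole of CJL-II §5 with the `L¹ → L²` theory of
`𝔎_e`, Lemma 10/§7 — is not in the tree). (The other retired facts of this file,
`CarlenJauslinLieb2021_thm2` and `CarlenJauslinLieb2021_thm3` — CJL-II Theorems 2 and 3 verbatim,
misstated in print — are treated in the two §Erratum sections above.)

## CJL-II Theorem 6: the corrected rendering (vendored as `CarlenJauslinLieb2021_thm6_rightDeriv` in `LiebSimpleEquationCondensateFraction.lean`)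

Elaborated against this file on 2026-08-15 (`lean check` rc 0; no axioms beyond `propext`,
`Classical.choice`, `Quot.sound`) and vendored the same day, docstring and body verbatim, as the
parameter-free `Prop`-valued definition `CarlenJauslinLieb2021_thm6_rightDeriv` of the sibling file
`LiebSimpleEquationCondensateFraction.lean` (cite item `wi-24851`), which imports this file and
refers back to this section as the design record of the rendering (proved there: the projections
`.rightDeriv`, `.asymptotics`). Docstring (delimiters and the provenance tag's brackets altered so
that this module docstring neither closes early nor carries a declaration tag):

````
/‐‐ **CJL-II Theorem 6 (condensate fraction); `η` as the right `μ`-derivative of the pinned energy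
along a pinned branch.** "Assume that `(1 + |x|⁴)v ∈ L¹(ℝ³) ∩ L²(ℝ³)`. The non-condensed fraction
`η` defined in (eta) [`η = ∂_μ e_μ|_{μ=0}`, `e_μ` the energy of the pinned system (simpleq_eta) =
(1.20), `(−Δ + 2μ + 4e_μ)u_μ = (1 − u_μ)v + 2ρe_μ u_μ∗u_μ`, `e_μ = (ρ/2)∫(1 − u_μ)v`, at density
`ρ`; §5: "`e₀ = e`, and we write `u = u₀` to denote the solution of the simple equation"] satisfies
`η = ρ∫v𝔎_e u / (1 − ρ∫v𝔎_e(2u − ρu∗u))` [(etaf) = (1.25)]. As `ρ → 0`, `η` goes to `0`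
asymptotically as `η ∼ 8√(ρa₀³)/(3√π)` [(eta_asym)] where `a₀` is the scattering length of `v`."
Rendering (see the module docstring, "Rendering decisions"; this definition REPLACES the deprecated
first rendering `CarlenJauslinLieb2021_thm6`, whose two-sided `eta` is identically `0`):
(a) for every solution triple `(ρ, e, u)`, `ρ, e > 0`, every branch `μ ↦ (e_μ, u_μ)`, `0 ≤ μ < μ₀`,
of solutions of the pinned system at density `ρ` (`IsPinnedSolution v ρ μ (e_μ) (u_μ)`) with
`e_0 = e`, `u_0 = u`, along which `μ ↦ u_μ` is differentiable at `0⁺` in `L²(ℝ³)` (some `s ∈ L²`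
with `‖(u_μ − u)/μ − s‖₂ → 0` as `μ → 0⁺`), the pinned energy has a right derivative at `μ = 0`
and it equals (1.25): `HasDerivWithinAt e_· (etaFormula v ρ e u) (Ici 0) 0`. This is the content of
the derivation in §5 ("Differentiating (simpleq_eta) in `μ` and setting `μ = 0`":
`(2 + 4η)u + (−Δ + 4e)s = −sv + 4ρe s∗u + 2ρη u∗u`, `s = 𝔎_e(2ηρ u∗u − 2u − 4ηu)`,
`η = −(ρ/2)∫sv`, solved for `η`; along such a branch the denominator of (1.25) cannot vanish, since
the derivation gives `η·(1 − ρ∫v𝔎_e(2u − ρu∗u)) = ρ∫v𝔎_e u` with a positive right side, `𝔎_e`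
having a positive kernel (§1.2) — cf. Remark 17, where only the SIGN of the denominator is at
issue). The derivative is one-sided because the pinned system has no solution in the physical
class for `μ < 0` (`IsPinnedSolution.mu_nonneg`, `LiebSimpleEquationPinned.lean`); the existence of
the branch and its `μ`-differentiability ("in the same way as … the differentiability of `ρ` with
respect to `e`", i.e. in `L²(ℝ³)` as in Theorem 3), which §5 asserts with "the details of these
two proofs … left to the reader", are HYPOTHESES here, not conclusions.
(b) `etaFormula v ρ e u ∼ 8√(ρa₀³)/(3√π)` as `ρ → 0`, uniformly over solution triples (`|F − X| ≤ εX`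
for `0 < ρ < ρ₀(ε)`), with `a₀ = scatteringLengthOf v φ` for a scattering solution `φ` whose
existence is part of the statement (as in `CarlenJauslinLieb2020_thm2`): this is (eta_asym) as §5
proves it, for the closed formula (etaf) (`η = (4√(2e)/(3π))a₀ + o(√e)`, then `e = 2πρa₀ + o(ρ)`
from CJL-I Theorem 2). ⟦cite: CarlenJauslinLieb2021, Theorem 6 and §5⟧ ‐/
````

(with `⟦cite: …⟧` to be restored to the bracketed provenance tag and `/‐‐ … ‐/` to docstring
delimiters).

Body (the term of type `Prop`):

````
  ∀ (v : Space → ℝ), IsWeightedPotential v → 0 < ∫ x, v x →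
    (∀ (ρ e : ℝ) (u : Space → ℝ), 0 < ρ → 0 < e → IsSolution v ρ e u →
      ∀ (eμ : ℝ → ℝ) (uμ : ℝ → Space → ℝ) (s : Space → ℝ), eμ 0 = e → uμ 0 = u →
        (∃ μ₀ : ℝ, 0 < μ₀ ∧ ∀ μ : ℝ, 0 ≤ μ → μ < μ₀ → IsPinnedSolution v ρ μ (eμ μ) (uμ μ)) →
        MemLp s 2 →
        Tendsto (fun μ : ℝ => eLpNorm (fun x => (uμ μ x - u x) / μ - s x) 2 volume)
          (𝓝[>] 0) (𝓝 0) →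
        HasDerivWithinAt eμ (etaFormula v ρ e u) (Ici 0) 0) ∧
    (∃ φ : Space → ℝ, IsScatteringSolution v φ ∧
      ∀ ε : ℝ, 0 < ε → ∃ ρ₀ : ℝ, 0 < ρ₀ ∧
        ∀ (ρ e : ℝ) (u : Space → ℝ), 0 < ρ → ρ < ρ₀ → 0 < e → IsSolution v ρ e u →
          |etaFormula v ρ e u - 8 * Real.sqrt (ρ * scatteringLengthOf v φ ^ 3) / (3 * Real.sqrt Real.pi)|
            ≤ ε * (8 * Real.sqrt (ρ * scatteringLengthOf v φ ^ 3) / (3 * Real.sqrt Real.pi)))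
````

## References

* [CarlenJauslinLieb2020] E. A. Carlen, I. Jauslin, E. H. Lieb, *Analysis of a simple equation for
  the ground state energy of the Bose gas*, Pure Appl. Anal. 2 (2020) 659–684, arXiv:1912.04987:
  Theorem 1, Theorem 2, (1.5)–(1.6), (1.21), §3.2 (scattering length, Lemma 3.1).
* [CarlenJauslinLieb2021] E. A. Carlen, I. Jauslin, E. H. Lieb, *Analysis of a simple equation for
  the ground state of the Bose gas II: monotonicity, convexity, and condensate fraction*, SIAM J.
  Math. Anal. 53 (2021) 5322–5360, arXiv:2010.13882: §1 (standing hypotheses), Theorem 2,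
  Theorem 3, Theorem 6 and its proof in §5 (equation labels of the arXiv version: (simp), (Ke),
  (simpleq_eta), (eta), (etaf), (eta_asym)); §2 (proof of Theorem 2: (kappa), (betadef),
  (U1hat), (U1decay), (boundU1), (udecay), (fourdecay)).
* [Lieb1963] E. H. Lieb, *Simplified approach to the ground-state energy of an imperfect Bose
  gas*, Phys. Rev. 130 (1963) 2518–2528.
* [Jauslin2022] I. Jauslin, *Review of a simplified approach to study the Bose gas at all
  densities*, in: The Physics and Mathematics of Elliott Lieb, EMS Press (2022), arXiv:2202.07637:
  Theorem 4.4 (repeats CJL-II Theorem 2 with the printed `β`).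
* [Jauslin2025] I. Jauslin, *An Introduction to Lieb's Simplified Approach to the Bose Gas*,
  SpringerBriefs in Physics (2025), arXiv:2308.00290: Lemma 6.8 (idem).
-/

noncomputable section

open MeasureTheory Filter Set
open scoped ENNReal Topology

namespace Literature.MathematicalPhysics.QuantumManyBody

/-- **Lieb's simple equation** (the requested notion `LiebSimpleEquation`, as a predicate):
`LiebSimpleEquation 𝒱 ρ e u` iff `u : ℝ³ → ℝ` is a physical solution of
`(−Δ + 4e + 𝒱)u = 𝒱 + 2eρ u∗u`, `e = (ρ/2)∫(1 − u)𝒱` (integrable, `0 ≤ u ≤ 1`, mild form) —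
a reducible synonym of `LiebSimpleEquation.IsSolution` (objects file), provided so that the notion
has a declaration of its own name. [cite: CarlenJauslinLieb2020, (1.1)–(1.2) and (1.5)] -/
abbrev LiebSimpleEquation (𝒱 : BoseGas.Space → ℝ) (ρ e : ℝ) (u : BoseGas.Space → ℝ) : Prop :=
  LiebSimpleEquation.IsSolution 𝒱 ρ e u

/-- `LiebSimpleEquation 𝒱 ρ e u ↔ IsSolution 𝒱 ρ e u` (by definition). [folklore] -/
theorem liebSimpleEquation_iff (𝒱 : BoseGas.Space → ℝ) (ρ e : ℝ) (u : BoseGas.Space → ℝ) :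
    LiebSimpleEquation 𝒱 ρ e u ↔ LiebSimpleEquation.IsSolution 𝒱 ρ e u := Iff.rfl

namespace LiebSimpleEquation

open BoseGas (Space)

/-- `(3 : ℝ≥0∞)/2 < 2`: square-integrable potentials satisfy the exponent condition `p > 3/2` of
CJL-I Theorem 1. [folklore] -/
theorem three_halves_lt_two : (3 : ℝ≥0∞) / 2 < 2 := by
  rw [ENNReal.div_lt_iff (Or.inl (by norm_num)) (Or.inl (by norm_num))]
  norm_num

/-! ## Standing hypotheses of CJL-II and the printed constants -/

/-- **The standing hypothesis of CJL-II** on the pair potential: "`v` is a given non-negative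
radial function … with `(1 + |x|⁴)v ∈ L¹(ℝ³) ∩ L²(ℝ³)`" (CJL-II §1, first paragraph; the
hypothesis of Theorems 2, 3, 6, 7). [cite: CarlenJauslinLieb2021, §1 and Theorems 2, 3, 6] -/
structure IsWeightedPotential (v : Space → ℝ) : Prop where
  nonneg : ∀ x, 0 ≤ v x
  radial : ∀ ⦃x y : Space⦄, ‖x‖ = ‖y‖ → v x = v y
  integrable : Integrable fun x => (1 + ‖x‖ ^ 4) * v x
  memLp_two : MemLp (fun x => (1 + ‖x‖ ^ 4) * v x) 2

/-- A CJL-II potential is integrable (`0 ≤ v ≤ (1 + |x|⁴)v`). [cite: CarlenJauslinLieb2021, §1] -/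
theorem IsWeightedPotential.integrable_self {v : Space → ℝ} (hv : IsWeightedPotential v) :
    Integrable v := by
  have hmeas : AEStronglyMeasurable v volume := by
    have h1 : AEStronglyMeasurable (fun x : Space => (1 + ‖x‖ ^ 4)⁻¹) volume := by
      refine (Continuous.aestronglyMeasurable ?_)
      refine Continuous.inv₀ (by fun_prop) fun x => ?_
      positivity
    have h2 := h1.mul hv.integrable.aestronglyMeasurable
    refine h2.congr (Eventually.of_forall fun x => ?_)
    have hx : (1 + ‖x‖ ^ 4) ≠ 0 := by positivity
    simp only [Pi.mul_apply]
    field_simp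
  refine hv.integrable.mono hmeas (Eventually.of_forall fun x => ?_)
  have h0 := hv.nonneg x
  have h1 : v x ≤ (1 + ‖x‖ ^ 4) * v x := by nlinarith [pow_nonneg (norm_nonneg x) 4]
  rw [Real.norm_of_nonneg h0, Real.norm_of_nonneg (by positivity)]
  exact h1

/-- A CJL-II potential is square-integrable (`0 ≤ v ≤ (1 + |x|⁴)v`), so CJL-I Theorems 1–2
apply to it (`p = 2 > 3/2`). [cite: CarlenJauslinLieb2021, §1] -/
theorem IsWeightedPotential.memLp_two_self {v : Space → ℝ} (hv : IsWeightedPotential v) :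
    MemLp v 2 := by
  have hb : ∀ x, ‖v x‖ ≤ ‖(1 + ‖x‖ ^ 4) * v x‖ := fun x => by
    have h0 := hv.nonneg x
    rw [Real.norm_of_nonneg h0, Real.norm_of_nonneg (by positivity)]
    nlinarith [pow_nonneg (norm_nonneg x) 4]
  exact hv.memLp_two.mono hv.integrable_self.aestronglyMeasurable (Eventually.of_forall hb)

/-- A CJL-II potential has a finite second moment, `|x|²v ∈ L¹` (`|x|² ≤ 1 + |x|⁴`); this is the
`‖x²v‖₁ < ∞` behind the bound `β ≤ ρ‖x²v‖₁` of Theorem 2. [cite: CarlenJauslinLieb2021, §1 and Theorem 2] -/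
theorem IsWeightedPotential.integrable_sq_mul {v : Space → ℝ} (hv : IsWeightedPotential v) :
    Integrable fun x => ‖x‖ ^ 2 * v x := by
  have hmeas : AEStronglyMeasurable (fun x : Space => ‖x‖ ^ 2 * v x) volume :=
    (continuous_norm.pow 2).aestronglyMeasurable.mul hv.integrable_self.aestronglyMeasurable
  refine hv.integrable.mono hmeas (Eventually.of_forall fun x => ?_)
  have h0 := hv.nonneg x
  have h2 : ‖x‖ ^ 2 ≤ 1 + ‖x‖ ^ 4 := by nlinarith [sq_nonneg (‖x‖ ^ 2 - 1), sq_nonneg ‖x‖]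
  rw [Real.norm_of_nonneg (by positivity), Real.norm_of_nonneg (by positivity)]
  exact mul_le_mul_of_nonneg_right h2 h0

/-- **`e⋆ := √2 π³ / ‖v‖₁²`**, the printed low-energy threshold of CJL-II Theorem 3 (which
asserts monotonicity and `ρ′ ≤ 16/‖v‖₁` for `e < e⋆`; misstated, see the module docstring
§Erratum), also the window of Theorem 5 (and of the retired first rendering of Theorem 6, see the
module docstring, §Verdict clean-up); `‖v‖₁ = ∫v` for `v ≥ 0`. [cite: CarlenJauslinLieb2021, Theorem 3] -/
def eStar (v : Space → ℝ) : ℝ :=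
  Real.sqrt 2 * Real.pi ^ 3 / (∫ x, v x) ^ 2

/-- **The printed high-energy threshold `2³‖v‖₂⁴/π⁴`** of CJL-II Theorem 3 (which asserts
monotonicity also for `e > 2³‖v‖₂⁴/π⁴`; see the module docstring §Erratum); `‖v‖₂⁴ = (∫v²)²`.
[cite: CarlenJauslinLieb2021, Theorem 3] -/
def eHigh (v : Space → ℝ) : ℝ :=
  2 ^ 3 * (∫ x, v x ^ 2) ^ 2 / Real.pi ^ 4

/-- **`β := ρ ∫ |x|² v (1 − u) dx`** of CJL-II Theorem 2 (there `β ≤ ρ‖x²v‖₁`).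
[cite: CarlenJauslinLieb2021, Theorem 2] -/
def decayBeta (v : Space → ℝ) (ρ : ℝ) (u : Space → ℝ) : ℝ :=
  ρ * ∫ x, ‖x‖ ^ 2 * (v x * (1 - u x))

/-- **The coefficient `√(2 + β)/(2π²√e)`** of the `|x|⁻⁴` tail of `ρu` in CJL-II Theorem 2.
[cite: CarlenJauslinLieb2021, Theorem 2] -/
def decayCoeff (v : Space → ℝ) (ρ e : ℝ) (u : Space → ℝ) : ℝ :=
  Real.sqrt (2 + decayBeta v ρ u) / (2 * Real.pi ^ 2 * Real.sqrt e)

/-- **The remainder `R(x) := ρu(x) − √(2+β)/(2π²√e)·|x|⁻⁴`** of CJL-II Theorem 2 (junk value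
`ρu(0)` at `x = 0`, where `|x|⁻⁴ = 0⁻¹ = 0` in Lean; irrelevant for the `Lᵖ` statements about
`|x|⁴R`). [cite: CarlenJauslinLieb2021, Theorem 2] -/
def decayRemainder (v : Space → ℝ) (ρ e : ℝ) (u : Space → ℝ) (x : Space) : ℝ :=
  ρ * u x - decayCoeff v ρ e u / ‖x‖ ^ 4

/-- **The tail coefficient `√(2 + β/3)/(2π²√e)` that the proof of CJL-II Theorem 2 establishes**
(with `β = decayBeta` as printed in (betadef)). The proof (§2) sets `κ := |k|/(2√e)`, expands
`(ρ/2e)Ŝ = 1 − β′κ² + O(κ⁴)` with `β′ = −(ρ/4e)∂²_κŜ(0)`, puts `β′` into the model function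
`Û₁` ((U1hat)) and computes `lim_{|x|→∞} |x|⁴U₁(x) = √(2 + β′)/(2π²√e)` ((U1decay)); the
remainder `Û₂ = ρû − Û₁` is controlled through `Δ²_k Û₂ ∈ L¹ ∩ L²` computed classically off
`k = 0`, a test that is blind to a residual `a|k|` term (`Δ²|k| = −8πδ`), so the tail of `u` is
exactly the one built into `Û₁` and `Û₁` matches `û` to the required order iff `β′` is the true
second-order coefficient. The text identifies `β′` with the `β` of (betadef), but for the radial
`S = v(1 − u)` (convention `Ŝ(k) = ∫e^{ikx}S`, `Ŝ(k) = 4π∫S(r)(sin|k|r/|k|r)r²dr`) one has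
`Ŝ(k) = Ŝ(0) − (|k|²/6)∫|x|²S + O(|k|⁴)` (the spherical average of `(k̂·x̂)²` is `1/3`:
`integral_inner_sq_mul_eq_of_radial` below proves `∫(k·x)²f = (|k|²/3)∫|x|²f` for radial `f`), so
`β′ = (ρ/3)∫|x|²v(1 − u) = β/3`; the printed `β = ρ∫|x|²v(1 − u)` is what the non-averaged
expansion `e^{ik·x} ≈ 1 − |k|²|x|²/2` would give. Consistently, CJL-I §4 finds
`ρu ∼ √(1/(2e) + β_I)/(π²|x|⁴)` with `(ρ/2e)Ŝ(k) = 1 − β_I k²`, i.e. the same `√(2 + β/3)/(2π²√e)`.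
[cite: CarlenJauslinLieb2021, Theorem 2 and §2 ((kappa), (betadef), (U1hat), (U1decay))] -/
def correctedDecayCoeff (v : Space → ℝ) (ρ e : ℝ) (u : Space → ℝ) : ℝ :=
  Real.sqrt (2 + decayBeta v ρ u / 3) / (2 * Real.pi ^ 2 * Real.sqrt e)

/-- The remainder `R(x) := ρu(x) − √(2 + β/3)/(2π²√e)·|x|⁻⁴` of CJL-II Theorem 2 with the
coefficient its proof establishes (see `correctedDecayCoeff`; junk value `ρu(0)` at `x = 0`).
[cite: CarlenJauslinLieb2021, Theorem 2 and §2] -/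
def correctedDecayRemainder (v : Space → ℝ) (ρ e : ℝ) (u : Space → ℝ) (x : Space) : ℝ :=
  ρ * u x - correctedDecayCoeff v ρ e u / ‖x‖ ^ 4

/-- `correctedDecayCoeff = √(2 + β/3)/(2π²√e)` (unfolding). [cite: CarlenJauslinLieb2021, Theorem 2 and §2] -/
theorem correctedDecayCoeff_eq (v : Space → ℝ) (ρ e : ℝ) (u : Space → ℝ) :
    correctedDecayCoeff v ρ e u =
      Real.sqrt (2 + decayBeta v ρ u / 3) / (2 * Real.pi ^ 2 * Real.sqrt e) := rfl

/-- `R'(x) = ρu(x) − correctedDecayCoeff/|x|⁴` (unfolding). [cite: CarlenJauslinLieb2021, Theorem 2 and §2] -/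
theorem correctedDecayRemainder_apply (v : Space → ℝ) (ρ e : ℝ) (u : Space → ℝ) (x : Space) :
    correctedDecayRemainder v ρ e u x = ρ * u x - correctedDecayCoeff v ρ e u / ‖x‖ ^ 4 := rfl

/-! ## CJL-I: existence and uniqueness (the density function `ρ(e)`) -/

/-- **CJL-I Theorem 1 (existence and uniqueness), `d = 3`.** "Let `𝒱 ∈ L¹(ℝᵈ) ∩ Lᵖ(ℝᵈ)`,
`p > max{d/2, 1}`, be non-negative. Then there is a constructively defined continuous function
`ρ(e)` on `(0,∞)` such that `lim_{e→0} ρ(e) = 0` and `lim_{e→∞} ρ(e) = ∞` and such that for any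
`e` and `ρ = ρ(e)`, the system (1.1)–(1.2) has a unique integrable solution `u` satisfying
`0 ≤ u ≤ 1` (1.5). Moreover, if `ρ ≠ ρ(e)`, the system (1.1)–(1.2) has no integrable solution
satisfying (1.5)." Rendered on `ℝ³` (`p > 3/2`), for `e > 0`, with the tacit `𝒱 ≢ 0` made explicit
(`0 < ∫𝒱`), solutions in the sense of `IsSolution` (integrable, `0 ≤ u ≤ 1`, mild form (1.10),
energy constraint (1.2)). [cite: CarlenJauslinLieb2020, Theorem 1] -/
def CarlenJauslinLieb2020_thm1 : Prop :=
  ∀ (𝒱 : Space → ℝ) (p : ℝ≥0∞), 3 / 2 < p → (∀ x, 0 ≤ 𝒱 x) → Integrable 𝒱 → MemLp 𝒱 p →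
    0 < ∫ x, 𝒱 x →
    ∃ ρf : ℝ → ℝ, ContinuousOn ρf (Ioi 0) ∧ Tendsto ρf (𝓝[>] 0) (𝓝 0) ∧
      Tendsto ρf atTop atTop ∧
      ∀ e : ℝ, 0 < e →
        (∃! u : Space → ℝ, IsSolution 𝒱 (ρf e) e u) ∧
        ∀ ρ : ℝ, ρ ≠ ρf e → ∀ u : Space → ℝ, ¬ IsSolution 𝒱 ρ e u

/-! ### CJL-I Theorem 2 -/

/-- **CJL-I Theorem 2 (asymptotics of the energy for `d = 3`).** "Let `𝒱` be non-negative,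
integrable and square-integrable. Then, for each `ρ > 0` there is at least one `e > 0` such that
`ρ = ρ(e)`. For any such `ρ` and `e` we have the following bounds for low and high density. For low
density, `e = 2πρa(1 + (128/(15√π))√(ρa³) + o(√ρ))`, where `a` is the scattering length of the
potential [`4πa = ∫𝒱(1 − φ)`, §3.2]. For high density, in any dimension, `e = (ρ/2)∫𝒱(x)dx + o(ρ)`."
Rendered with `𝒱 ≢ 0` explicit; "`ρ = ρ(e)`" as "a solution exists at `(ρ, e)`" (Theorem 1); the
`o(·)` uniform over solution triples; `a = scatteringLengthOf 𝒱 φ` for a scattering solution `φ`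
whose existence is part of the statement (CJL's `φ = lim_{e→0} K_e𝒱`, (3.8)).
[cite: CarlenJauslinLieb2020, Theorem 2] -/
def CarlenJauslinLieb2020_thm2 : Prop :=
  ∀ (𝒱 : Space → ℝ), (∀ x, 0 ≤ 𝒱 x) → Integrable 𝒱 → MemLp 𝒱 2 → 0 < ∫ x, 𝒱 x →
    (∀ ρ : ℝ, 0 < ρ → ∃ e : ℝ, 0 < e ∧ ∃ u, IsSolution 𝒱 ρ e u) ∧
    (∃ φ : Space → ℝ, IsScatteringSolution 𝒱 φ ∧
      ∀ ε : ℝ, 0 < ε → ∃ ρ₀ : ℝ, 0 < ρ₀ ∧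
        ∀ (ρ e : ℝ) (u : Space → ℝ), 0 < ρ → ρ < ρ₀ → 0 < e → IsSolution 𝒱 ρ e u →
          |e - 2 * Real.pi * ρ * scatteringLengthOf 𝒱 φ *
                (1 + 128 / (15 * Real.sqrt Real.pi) * Real.sqrt (ρ * scatteringLengthOf 𝒱 φ ^ 3))|
            ≤ ε * (2 * Real.pi * ρ * scatteringLengthOf 𝒱 φ) * Real.sqrt ρ) ∧
    (∀ ε : ℝ, 0 < ε → ∃ ρ₁ : ℝ,
      ∀ (ρ e : ℝ) (u : Space → ℝ), ρ₁ < ρ → 0 < e → IsSolution 𝒱 ρ e u →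
        |e - ρ / 2 * ∫ x, 𝒱 x| ≤ ε * ρ)

/-! ## CJL-II: the condensate fraction (Theorem 6; Theorem 2, decay, and Theorem 3, monotonicity: see §Erratum)

No declaration here. CJL-II Theorem 6 in its corrected rendering is the named fact
`CarlenJauslinLieb2021_thm6_rightDeriv` of the sibling file `LiebSimpleEquationCondensateFraction.lean`,
which imports this file (hence it is not declared here; its design record is the module docstring,
§"CJL-II Theorem 6: the corrected rendering"). The first rendering, the named fact
`CarlenJauslinLieb2021_thm6` (two-sided `eta`, identically `0`), stood here until the verdict
clean-up of 2026-08-15 retired it: it is refuted in the tree (`not_CarlenJauslinLieb2021_thm6_of_thm1`,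
`LiebSimpleEquationPinned.lean`; `not_CarlenJauslinLieb2021_thm6`,
`LiebSimpleEquationFactsRefuted.lean` — both state it verbatim in their types); see the module
docstring, §Verdict clean-up. -/

/-! ## Consequences: Theorem 1 pins `densityFn`; elementary bounds -/

/-- Under CJL-I Theorem 1, the set of solution densities at energy `e > 0` is the singleton
`{ρ(e)}`; hence any solution triple `(ρ, e, u)` has `ρ = densityFn 𝒱 e`.
[cite: CarlenJauslinLieb2020, Theorem 1] -/
theorem solutionDensities_eq_singleton (h : CarlenJauslinLieb2020_thm1) {𝒱 : Space → ℝ} {p : ℝ≥0∞}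
    (hp : 3 / 2 < p) (h0 : ∀ x, 0 ≤ 𝒱 x) (h1 : Integrable 𝒱) (h2 : MemLp 𝒱 p)
    (hne : 0 < ∫ x, 𝒱 x) {ρ e : ℝ} (he : 0 < e) {u : Space → ℝ} (hu : IsSolution 𝒱 ρ e u) :
    solutionDensities 𝒱 e = {ρ} := by
  obtain ⟨ρf, -, -, -, hρf⟩ := h 𝒱 p hp h0 h1 h2 hne
  obtain ⟨hex, huniq⟩ := hρf e he
  have hρ : ρ = ρf e := by
    by_contra hne'
    exact huniq ρ hne' u hu
  ext ρ'
  simp only [solutionDensities, mem_setOf_eq, mem_singleton_iff]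
  constructor
  · rintro ⟨u', hu'⟩
    by_contra hne'
    exact huniq ρ' (hρ ▸ hne') u' hu'
  · rintro rfl
    exact ⟨u, hu⟩

/-- **`ρ = ρ(e)` for every solution triple** (CJL-I Theorem 1): if the system has a solution at
`(ρ, e)`, `e > 0`, then `densityFn 𝒱 e = ρ`. [cite: CarlenJauslinLieb2020, Theorem 1] -/
theorem densityFn_eq_of_isSolution (h : CarlenJauslinLieb2020_thm1) {𝒱 : Space → ℝ} {p : ℝ≥0∞}
    (hp : 3 / 2 < p) (h0 : ∀ x, 0 ≤ 𝒱 x) (h1 : Integrable 𝒱) (h2 : MemLp 𝒱 p)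
    (hne : 0 < ∫ x, 𝒱 x) {ρ e : ℝ} (he : 0 < e) {u : Space → ℝ} (hu : IsSolution 𝒱 ρ e u) :
    densityFn 𝒱 e = ρ := by
  rw [densityFn, solutionDensities_eq_singleton h hp h0 h1 h2 hne he hu, csSup_singleton]

/-- **Existence and uniqueness at `ρ = ρ(e)`** (CJL-I Theorem 1) for the tree's `densityFn`:
for every `e > 0` there is exactly one solution `u` of the system at `(densityFn 𝒱 e, e)`.
[cite: CarlenJauslinLieb2020, Theorem 1] -/
theorem existsUnique_isSolution_densityFn (h : CarlenJauslinLieb2020_thm1) {𝒱 : Space → ℝ}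
    {p : ℝ≥0∞} (hp : 3 / 2 < p) (h0 : ∀ x, 0 ≤ 𝒱 x) (h1 : Integrable 𝒱) (h2 : MemLp 𝒱 p)
    (hne : 0 < ∫ x, 𝒱 x) {e : ℝ} (he : 0 < e) :
    ∃! u : Space → ℝ, IsSolution 𝒱 (densityFn 𝒱 e) e u := by
  obtain ⟨ρf, -, -, -, hρf⟩ := h 𝒱 p hp h0 h1 h2 hne
  obtain ⟨⟨u, hu, huniq'⟩, -⟩ := hρf e he
  rw [densityFn_eq_of_isSolution h hp h0 h1 h2 hne he hu]
  exact ⟨u, hu, huniq'⟩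

/-- Under CJL-I Theorem 1, `densityFn 𝒱` agrees on `(0,∞)` with the printed density function:
it is continuous on `(0,∞)`, tends to `0` at `0⁺` and to `∞` at `∞`. [cite: CarlenJauslinLieb2020, Theorem 1] -/
theorem continuousOn_densityFn (h : CarlenJauslinLieb2020_thm1) {𝒱 : Space → ℝ} {p : ℝ≥0∞}
    (hp : 3 / 2 < p) (h0 : ∀ x, 0 ≤ 𝒱 x) (h1 : Integrable 𝒱) (h2 : MemLp 𝒱 p)
    (hne : 0 < ∫ x, 𝒱 x) :
    ContinuousOn (densityFn 𝒱) (Ioi 0) ∧ Tendsto (densityFn 𝒱) (𝓝[>] 0) (𝓝 0) ∧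
      Tendsto (densityFn 𝒱) atTop atTop := by
  obtain ⟨ρf, hcont, hzero, htop, hρf⟩ := h 𝒱 p hp h0 h1 h2 hne
  have heq : ∀ e, 0 < e → densityFn 𝒱 e = ρf e := fun e he => by
    obtain ⟨⟨u, hu, -⟩, -⟩ := hρf e he
    exact densityFn_eq_of_isSolution h hp h0 h1 h2 hne he hu
  have heqOn : EqOn (densityFn 𝒱) ρf (Ioi 0) := fun e he => heq e he
  refine ⟨hcont.congr heqOn, ?_, ?_⟩
  · refine hzero.congr' ?_
    filter_upwards [self_mem_nhdsWithin] with e he using (heq e he).symm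
  · refine htop.congr' ?_
    filter_upwards [eventually_gt_atTop 0] with e he using (heq e he).symm

/-- `e⋆ > 0` for a non-trivial potential. [cite: CarlenJauslinLieb2021, Theorem 3] -/
theorem eStar_pos {v : Space → ℝ} (hv : 0 < ∫ x, v x) : 0 < eStar v := by
  unfold eStar; positivity

/-! ## CJL-II Theorem 2: the elementary conjunct; the printed versus the established tail

The corrected statement of CJL-II Theorem 2 (see `correctedDecayCoeff` for the discrepancy and the
module docstring, §Erratum (Theorem 2), for the printed statement and its refutation) reads, in
the conventions of the tree's rendering of the printed theorem — recorded here as text, not as a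
named fact (no consumer in the tree yet; a definition seat can vendor it verbatim when one appears):

```
∀ (v : Space → ℝ), IsWeightedPotential v → 0 < ∫ x, v x →
  (∀ (ρ e : ℝ) (u : Space → ℝ), 0 < ρ → 0 < e → IsSolution v ρ e u →
    MemLp (fun x => ‖x‖ ^ 4 * correctedDecayRemainder v ρ e u x) 2 ∧
    MemLp (fun x => ‖x‖ ^ 4 * correctedDecayRemainder v ρ e u x) ∞) ∧
  (∀ ρ₀ : ℝ, 0 < ρ₀ → ∃ C : ℝ,
    ∀ (ρ e : ℝ) (u : Space → ℝ), 0 < ρ → ρ < ρ₀ → 0 < e → IsSolution v ρ e u →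
      ∀ x : Space, ρ * Real.sqrt e * ‖x‖ ^ 4 * u x ≤ C)
```

What is proved below: `β ≤ ρ‖x²v‖₁` (the first printed assertion, `IsSolution.decayBeta_le`);
`β > 0` (`IsSolution.decayBeta_pos`), so the printed and the established coefficients differ
(`IsSolution.decayCoeff_ne_correctedDecayCoeff`); the `L^∞` assertion is insensitive to the
coefficient (`memLp_top_decayRemainder_iff`) while the `L²` assertion tolerates at most one
coefficient (`eq_of_memLp_two_tail`), whence the verbatim `L²` conjunct and the established one
exclude each other for every solution triple (`IsSolution.not_memLp_two_decayRemainder_and`). -/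

/-- `β ≥ 0` for a solution triple (`v ≥ 0`, `u ≤ 1`, `ρ ≥ 0`). [cite: CarlenJauslinLieb2021, Theorem 2] -/
theorem decayBeta_nonneg {v : Space → ℝ} {ρ e : ℝ} {u : Space → ℝ} (hv : ∀ x, 0 ≤ v x)
    (hu : IsSolution v ρ e u) (hρ : 0 ≤ ρ) : 0 ≤ decayBeta v ρ u := by
  unfold decayBeta
  refine mul_nonneg hρ (integral_nonneg fun x => ?_)
  have h1 := hu.le_one x
  exact mul_nonneg (by positivity) (mul_nonneg (hv x) (by linarith))

/-- **`β ≤ ρ‖x²v‖₁`**, the bound on `β = ρ∫|x|²v(1 − u)` printed in CJL-II Theorem 2 (there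
"`β = ρ∫|x|²v(1−u)dx ≤ ρ‖x²v‖₁`"): immediate from `0 ≤ u ≤ 1`, `v ≥ 0` (for `v ≥ 0`,
`‖x²v‖₁ = ∫|x|²v`). This is the first conjunct of the printed Theorem 2, provable as it
stands. [cite: CarlenJauslinLieb2021, Theorem 2] -/
theorem IsSolution.decayBeta_le {v : Space → ℝ} {ρ e : ℝ} {u : Space → ℝ}
    (hv : IsWeightedPotential v) (hu : IsSolution v ρ e u) (hρ : 0 ≤ ρ) :
    decayBeta v ρ u ≤ ρ * ∫ x, ‖x‖ ^ 2 * v x := by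
  unfold decayBeta
  refine mul_le_mul_of_nonneg_left ?_ hρ
  refine integral_mono_of_nonneg (Eventually.of_forall fun x => ?_) hv.integrable_sq_mul
    (Eventually.of_forall fun x => ?_)
  · have h1 := hu.le_one x
    exact mul_nonneg (by positivity) (mul_nonneg (hv.nonneg x) (by linarith))
  · have h1 := hu.nonneg x
    have h0 := hv.nonneg x
    have h2 : v x * (1 - u x) ≤ v x := by nlinarith
    exact mul_le_mul_of_nonneg_left h2 (by positivity)

/-- The first assertion of CJL-II Theorem 2 as printed (`β ≤ ρ‖x²v‖₁` for every solution
triple with `ρ > 0`, in the quantifier shape of the tree's rendering of the theorem) holds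
outright. [cite: CarlenJauslinLieb2021, Theorem 2] -/
theorem CarlenJauslinLieb2021_thm2_betaBound :
    ∀ (v : Space → ℝ), IsWeightedPotential v → 0 < ∫ x, v x →
      ∀ (ρ e : ℝ) (u : Space → ℝ), 0 < ρ → 0 < e → IsSolution v ρ e u →
        decayBeta v ρ u ≤ ρ * ∫ x, ‖x‖ ^ 2 * v x :=
  fun _ hv _ _ _ _ hρ _ hu => hu.decayBeta_le hv hρ.le

/-- A solution triple with `e > 0` and `v ≥ 0` has `ρ > 0` (`e = (ρ/2)∫(1 − u)v` with
`∫(1 − u)v ≥ 0`). [cite: CarlenJauslinLieb2020, (1.2)] -/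
theorem IsSolution.density_pos {v : Space → ℝ} {ρ e : ℝ} {u : Space → ℝ} (hu : IsSolution v ρ e u)
    (hv : ∀ x, 0 ≤ v x) (he : 0 < e) : 0 < ρ := by
  have hI : 0 ≤ ∫ x, (1 - u x) * v x :=
    integral_nonneg fun x => mul_nonneg (by linarith [hu.le_one x]) (hv x)
  have hE : e = ρ / 2 * ∫ x, (1 - u x) * v x := hu.energy
  rcases lt_or_ge 0 ρ with hρ | hρ
  · exact hρ
  · have : ρ / 2 * ∫ x, (1 - u x) * v x ≤ 0 := mul_nonpos_of_nonpos_of_nonneg (by linarith) hI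
    linarith

/-- `β > 0` for a solution triple with `ρ, e > 0`: `e = (ρ/2)∫(1 − u)v > 0` forces `(1 − u)v ≢ 0`,
hence `|x|²v(1 − u) ≢ 0`. (So the printed and the established tail coefficients of Theorem 2
never coincide.) [cite: CarlenJauslinLieb2021, Theorem 2] -/
theorem IsSolution.decayBeta_pos {v : Space → ℝ} {ρ e : ℝ} {u : Space → ℝ}
    (hv : IsWeightedPotential v) (hu : IsSolution v ρ e u) (hρ : 0 < ρ) (he : 0 < e) :
    0 < decayBeta v ρ u := by
  unfold decayBeta
  refine mul_pos hρ ?_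
  -- `g = (1 - u) v` has positive integral, hence support of positive measure
  set g : Space → ℝ := fun x => (1 - u x) * v x with hg
  set f : Space → ℝ := fun x => ‖x‖ ^ 2 * (v x * (1 - u x)) with hf
  have hg0 : ∀ x, 0 ≤ g x := fun x => mul_nonneg (by linarith [hu.le_one x]) (hv.nonneg x)
  have hf0 : ∀ x, 0 ≤ f x := fun x =>
    mul_nonneg (by positivity) (mul_nonneg (hv.nonneg x) (by linarith [hu.le_one x]))
  have hgi : Integrable g := hu.integrable_one_sub_mul hv.integrable_self
  have hfi : Integrable f := by
    have h1 : Integrable (fun x => (1 - u x) * (‖x‖ ^ 2 * v x)) := by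
      refine hv.integrable_sq_mul.bdd_mul (c := 1) ?_ (Eventually.of_forall fun x => ?_)
      · exact aestronglyMeasurable_const.sub hu.integrable.aestronglyMeasurable
      · have := hu.nonneg x
        have := hu.le_one x
        rw [Real.norm_eq_abs, abs_le]
        constructor <;> linarith
    exact h1.congr (Eventually.of_forall fun x => by simp only [hf]; ring)
  have hgpos : 0 < ∫ x, g x := by
    have hE : e = ρ / 2 * ∫ x, (1 - u x) * v x := hu.energy
    rcases lt_or_ge 0 (∫ x, g x) with hpos | hle
    · exact hpos
    · have : ρ / 2 * ∫ x, g x ≤ 0 := mul_nonpos_of_nonneg_of_nonpos (by positivity) hle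
      simp only [hg] at this
      linarith
  have hsupp : 0 < volume (Function.support g) :=
    (integral_pos_iff_support_of_nonneg_ae (Eventually.of_forall hg0) hgi).mp hgpos
  rw [integral_pos_iff_support_of_nonneg_ae (Eventually.of_forall hf0) hfi]
  -- `support g ⊆ support f ∪ {0}` and `{0}` is null
  have hsub : Function.support g ⊆ Function.support f ∪ {0} := by
    intro x hx
    by_cases hx0 : x = 0
    · exact Or.inr hx0
    · left
      rw [Function.mem_support] at hx ⊢
      have hn : ‖x‖ ^ 2 ≠ 0 := pow_ne_zero _ (norm_ne_zero_iff.mpr hx0)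
      simp only [hf]
      rw [mul_comm (v x)]
      exact mul_ne_zero hn hx
  have h0 : volume ({0} : Set Space) = 0 := measure_singleton 0
  have hle : volume (Function.support g) ≤ volume (Function.support f) :=
    (measure_mono hsub).trans ((measure_union_le _ _).trans (by rw [h0, add_zero]))
  exact hsupp.trans_le hle

/-- The printed tail coefficient `√(2+β)/(2π²√e)` and the established one `√(2+β/3)/(2π²√e)`
differ for every solution triple with `ρ, e > 0` (`β > 0`). [cite: CarlenJauslinLieb2021, Theorem 2 and §2] -/
theorem IsSolution.decayCoeff_ne_correctedDecayCoeff {v : Space → ℝ} {ρ e : ℝ} {u : Space → ℝ}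
    (hv : IsWeightedPotential v) (hu : IsSolution v ρ e u) (hρ : 0 < ρ) (he : 0 < e) :
    decayCoeff v ρ e u ≠ correctedDecayCoeff v ρ e u := by
  intro hEq
  have hβ := hu.decayBeta_pos hv hρ he
  have hden : 0 < 2 * Real.pi ^ 2 * Real.sqrt e := by positivity
  simp only [decayCoeff, correctedDecayCoeff] at hEq
  rw [div_left_inj' hden.ne'] at hEq
  have hinj := (Real.sqrt_inj (by positivity) (by positivity)).mp hEq
  linarith

/-- Lebesgue measure on `ℝ³` is infinite. [folklore] -/
theorem volume_space_univ : volume (Set.univ : Set Space) = ∞ :=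
  measure_univ_of_isAddLeftInvariant _

/-- **At most one tail coefficient.** If `|x|⁴(w − c₁|x|⁻⁴)` and `|x|⁴(w − c₂|x|⁻⁴)` are both in
`L²(ℝ³)` then `c₁ = c₂`: off the (null) origin they differ by the constant `c₂ − c₁`, and a
non-zero constant is not square-integrable for the infinite Lebesgue measure. [folklore] -/
theorem eq_of_memLp_two_tail {w : Space → ℝ} {c₁ c₂ : ℝ}
    (h₁ : MemLp (fun x => ‖x‖ ^ 4 * (w x - c₁ / ‖x‖ ^ 4)) 2 volume)
    (h₂ : MemLp (fun x => ‖x‖ ^ 4 * (w x - c₂ / ‖x‖ ^ 4)) 2 volume) : c₁ = c₂ := by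
  have hdiff := h₂.sub h₁
  have hae : ((fun x => ‖x‖ ^ 4 * (w x - c₂ / ‖x‖ ^ 4)) - fun x => ‖x‖ ^ 4 * (w x - c₁ / ‖x‖ ^ 4))
      =ᵐ[volume] fun _ => c₁ - c₂ := by
    have h0 : ({0}ᶜ : Set Space) ∈ ae (volume : Measure Space) :=
      compl_mem_ae_iff.mpr (measure_singleton 0)
    filter_upwards [h0] with x hx
    have hx0 : x ≠ 0 := hx
    have hn : ‖x‖ ^ 4 ≠ 0 := pow_ne_zero _ (norm_ne_zero_iff.mpr hx0)
    simp only [Pi.sub_apply]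
    field_simp
    ring
  have hconst : MemLp (fun _ : Space => c₁ - c₂) 2 volume := (memLp_congr_ae hae).mp hdiff
  rw [memLp_const_iff two_ne_zero ENNReal.ofNat_ne_top] at hconst
  rcases hconst with hzero | hfin
  · exact sub_eq_zero.mp hzero
  · exact absurd volume_space_univ hfin.ne

/-- Off the origin, the verbatim and the corrected weighted remainders of Theorem 2 differ by the
constant `√(2+β/3)/(2π²√e) − √(2+β)/(2π²√e)`; the origin is Lebesgue-null. [cite: CarlenJauslinLieb2021, Theorem 2] -/
theorem normPow_mul_decayRemainder_ae_eq (v : Space → ℝ) (ρ e : ℝ) (u : Space → ℝ) :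
    (fun x => ‖x‖ ^ 4 * decayRemainder v ρ e u x) =ᵐ[volume]
      fun x => ‖x‖ ^ 4 * correctedDecayRemainder v ρ e u x +
        (correctedDecayCoeff v ρ e u - decayCoeff v ρ e u) := by
  have h0 : ({0}ᶜ : Set Space) ∈ ae (volume : Measure Space) :=
    compl_mem_ae_iff.mpr (measure_singleton 0)
  filter_upwards [h0] with x hx
  have hx0 : x ≠ 0 := hx
  have hn : ‖x‖ ^ 4 ≠ 0 := pow_ne_zero _ (norm_ne_zero_iff.mpr hx0)
  simp only [decayRemainder, correctedDecayRemainder]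
  field_simp
  ring

/-- **The `L^∞` assertion of Theorem 2 does not see the coefficient**: `|x|⁴R ∈ L^∞` for the
verbatim remainder iff for the corrected one (they differ by a constant a.e.). So the printed
`|x|⁴R ∈ L^∞(ℝ³)` is unaffected by the discrepancy in `β`. [cite: CarlenJauslinLieb2021, Theorem 2] -/
theorem memLp_top_decayRemainder_iff (v : Space → ℝ) (ρ e : ℝ) (u : Space → ℝ) :
    MemLp (fun x => ‖x‖ ^ 4 * decayRemainder v ρ e u x) ∞ volume ↔
      MemLp (fun x => ‖x‖ ^ 4 * correctedDecayRemainder v ρ e u x) ∞ volume := by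
  rw [memLp_congr_ae (normPow_mul_decayRemainder_ae_eq v ρ e u)]
  constructor
  · intro h
    have h' := h.sub (memLp_top_const (correctedDecayCoeff v ρ e u - decayCoeff v ρ e u))
    refine (memLp_congr_ae (Eventually.of_forall fun x => ?_)).mp h'
    simp only [Pi.sub_apply, add_sub_cancel_right]
  · intro h
    exact h.add (memLp_top_const _)

/-- **The verbatim `L²` assertion and the established one exclude each other** for every solution
triple with `ρ, e > 0`: by `eq_of_memLp_two_tail` both would force the two coefficients to agree,
contradicting `IsSolution.decayCoeff_ne_correctedDecayCoeff`. Since §2 of the source establishes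
the `L²` property for the corrected remainder, the `L²` conjunct of the printed Theorem 2 fails
for every solution triple, i.e. the printed theorem is refuted as soon as one solution exists
(CJL-I Theorem 1; carried out without any assumption on the corrected remainder in
`LiebSimpleEquationDecayErratum.lean`, `IsSolution.not_memLp_decayRemainder`).
[cite: CarlenJauslinLieb2021, Theorem 2 and §2] -/
theorem IsSolution.not_memLp_two_decayRemainder_and {v : Space → ℝ} {ρ e : ℝ} {u : Space → ℝ}
    (hv : IsWeightedPotential v) (hu : IsSolution v ρ e u) (hρ : 0 < ρ) (he : 0 < e) :
    ¬ (MemLp (fun x => ‖x‖ ^ 4 * decayRemainder v ρ e u x) 2 volume ∧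
        MemLp (fun x => ‖x‖ ^ 4 * correctedDecayRemainder v ρ e u x) 2 volume) := by
  rintro ⟨h₁, h₂⟩
  have h := eq_of_memLp_two_tail (w := fun x => ρ * u x) (c₁ := decayCoeff v ρ e u)
    (c₂ := correctedDecayCoeff v ρ e u) h₁ h₂
  exact hu.decayCoeff_ne_correctedDecayCoeff hv hρ he h

/-! ### The spherical average `1/3`: second moments of radial weights on `ℝ³`

The purely calculus step behind the discrepancy, certified: for a radial weight `f` on `ℝ³` and
every `k`, `∫(k·x)²f(x)dx = (|k|²/3)∫|x|²f(x)dx`; hence the second-order Taylor term of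
`Ŝ(k) = ∫e^{ikx}S = ∫(1 − (k·x)²/2 + …)S` for the radial `S = v(1 − u)` is `−(|k|²/6)∫|x|²S`,
not `−(|k|²/2)∫|x|²S`. Proof: coordinate reflections kill the mixed moments, coordinate swaps
equalise the diagonal ones, and the three diagonal moments add up to `∫|x|²f`. -/

/-- Negating the `i`-th coordinate of `ℝ³`, as a linear isometry. [folklore] -/
def coordReflection (i : Fin 3) : Space ≃ₗᵢ[ℝ] Space :=
  LinearIsometryEquiv.piLpCongrRight 2 fun j =>
    if j = i then LinearIsometryEquiv.neg ℝ else LinearIsometryEquiv.refl ℝ ℝ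

/-- `coordReflection i` negates the `i`-th coordinate. [folklore] -/
theorem coordReflection_apply_self (i : Fin 3) (x : Space) : coordReflection i x i = -x i := by
  simp [coordReflection, LinearIsometryEquiv.piLpCongrRight_apply]

/-- `coordReflection i` fixes the other coordinates. [folklore] -/
theorem coordReflection_apply_of_ne {i j : Fin 3} (h : j ≠ i) (x : Space) :
    coordReflection i x j = x j := by
  simp [coordReflection, LinearIsometryEquiv.piLpCongrRight_apply, h]

/-- Swapping the coordinates `i` and `j` of `ℝ³`, as a linear isometry. [folklore] -/
def coordSwap (i j : Fin 3) : Space ≃ₗᵢ[ℝ] Space :=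
  LinearIsometryEquiv.piLpCongrLeft 2 ℝ ℝ (Equiv.swap i j)

/-- `coordSwap i j` permutes the coordinates by the transposition `(i j)`. [folklore] -/
theorem coordSwap_apply (i j l : Fin 3) (x : Space) :
    coordSwap i j x l = x (Equiv.swap i j l) := by
  simp [coordSwap, LinearIsometryEquiv.piLpCongrLeft_apply, Equiv.piCongrLeft'_apply,
    Equiv.symm_swap]

/-- Lebesgue measure on `ℝ³` is invariant under linear isometries (change of variables).
[folklore] -/
theorem integral_comp_linearIsometryEquiv (L : Space ≃ₗᵢ[ℝ] Space) (g : Space → ℝ) :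
    ∫ x, g (L x) = ∫ x, g x :=
  L.measurePreserving.integral_comp L.toHomeomorph.measurableEmbedding g

/-- Mixed second moments of a radial weight vanish: `∫ xᵢxⱼf = 0` for `i ≠ j` (reflect `xᵢ`).
[folklore] -/
theorem integral_coord_mul_coord_mul_eq_zero {f : Space → ℝ}
    (hf : ∀ ⦃x y : Space⦄, ‖x‖ = ‖y‖ → f x = f y) {i j : Fin 3} (hij : i ≠ j) :
    ∫ x : Space, x i * x j * f x = 0 := by
  have h := integral_comp_linearIsometryEquiv (coordReflection i) (fun x => x i * x j * f x)
  have h2 : (fun x : Space => (coordReflection i x) i * (coordReflection i x) j *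
      f (coordReflection i x)) = fun x => -(x i * x j * f x) := by
    funext x
    rw [coordReflection_apply_self, coordReflection_apply_of_ne hij.symm,
      hf ((coordReflection i).norm_map x)]
    ring
  rw [h2, integral_neg] at h
  linarith

/-- Diagonal second moments of a radial weight agree: `∫ xᵢ²f = ∫ xⱼ²f` (swap `xᵢ`, `xⱼ`).
[folklore] -/
theorem integral_coord_sq_mul_eq {f : Space → ℝ}
    (hf : ∀ ⦃x y : Space⦄, ‖x‖ = ‖y‖ → f x = f y) (i j : Fin 3) :
    ∫ x : Space, x i ^ 2 * f x = ∫ x : Space, x j ^ 2 * f x := by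
  have h := integral_comp_linearIsometryEquiv (coordSwap i j) (fun x => x i ^ 2 * f x)
  have h2 : (fun x : Space => (coordSwap i j x) i ^ 2 * f (coordSwap i j x)) =
      fun x => x j ^ 2 * f x := by
    funext x
    rw [coordSwap_apply, Equiv.swap_apply_left, hf ((coordSwap i j).norm_map x)]
  rw [h2] at h
  exact h.symm

/-- `xⱼ²f` is integrable when `|x|²f` is (`xⱼ² ≤ |x|²`). [folklore] -/
theorem integrable_coord_sq_mul {f : Space → ℝ} (hint : Integrable fun x => ‖x‖ ^ 2 * f x)
    (hfm : AEStronglyMeasurable f volume) (j : Fin 3) :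
    Integrable fun x : Space => x j ^ 2 * f x := by
  refine hint.mono (((PiLp.continuous_apply 2 _ j).pow 2).aestronglyMeasurable.mul hfm)
    (Eventually.of_forall fun x => ?_)
  have hle : x j ^ 2 ≤ ‖x‖ ^ 2 := by
    rw [EuclideanSpace.real_norm_sq_eq]
    exact Finset.single_le_sum (fun i _ => sq_nonneg (x i)) (Finset.mem_univ j)
  rw [norm_mul, norm_mul, Real.norm_of_nonneg (sq_nonneg _),
    Real.norm_of_nonneg (by positivity : (0 : ℝ) ≤ ‖x‖ ^ 2)]
  exact mul_le_mul_of_nonneg_right hle (norm_nonneg _)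

/-- `xᵢxⱼf` is integrable when `|x|²f` is (`2|xᵢxⱼ| ≤ |x|²`). [folklore] -/
theorem integrable_coord_mul_coord_mul {f : Space → ℝ} (hint : Integrable fun x => ‖x‖ ^ 2 * f x)
    (hfm : AEStronglyMeasurable f volume) (i j : Fin 3) :
    Integrable fun x : Space => x i * x j * f x := by
  refine hint.mono
    ((((PiLp.continuous_apply 2 _ i).mul (PiLp.continuous_apply 2 _ j))).aestronglyMeasurable.mul
      hfm) (Eventually.of_forall fun x => ?_)
  have hi : x i ^ 2 ≤ ‖x‖ ^ 2 := by
    rw [EuclideanSpace.real_norm_sq_eq]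
    exact Finset.single_le_sum (fun i _ => sq_nonneg (x i)) (Finset.mem_univ i)
  have hj : x j ^ 2 ≤ ‖x‖ ^ 2 := by
    rw [EuclideanSpace.real_norm_sq_eq]
    exact Finset.single_le_sum (fun i _ => sq_nonneg (x i)) (Finset.mem_univ j)
  have hle : |x i * x j| ≤ ‖x‖ ^ 2 := by
    rw [abs_mul]
    nlinarith [abs_nonneg (x i), abs_nonneg (x j), sq_abs (x i), sq_abs (x j),
      sq_nonneg (|x i| - |x j|)]
  have hR : ‖‖x‖ ^ 2 * f x‖ = ‖x‖ ^ 2 * ‖f x‖ := by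
    rw [norm_mul, Real.norm_of_nonneg (by positivity : (0 : ℝ) ≤ ‖x‖ ^ 2)]
  have hL : ‖x i * x j * f x‖ = |x i * x j| * ‖f x‖ := by
    rw [norm_mul, Real.norm_eq_abs]
  rw [hL, hR]
  exact mul_le_mul_of_nonneg_right hle (norm_nonneg _)

/-- Each diagonal second moment of a radial weight is a third of `∫|x|²f`. [folklore] -/
theorem integral_coord_sq_mul_eq_third {f : Space → ℝ}
    (hf : ∀ ⦃x y : Space⦄, ‖x‖ = ‖y‖ → f x = f y) (hint : Integrable fun x => ‖x‖ ^ 2 * f x)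
    (hfm : AEStronglyMeasurable f volume) (i : Fin 3) :
    ∫ x : Space, x i ^ 2 * f x = 1 / 3 * ∫ x, ‖x‖ ^ 2 * f x := by
  have hI := integrable_coord_sq_mul hint hfm
  have hsum : ∫ x, ‖x‖ ^ 2 * f x = ∑ j : Fin 3, ∫ x : Space, x j ^ 2 * f x := by
    rw [← integral_finsetSum _ (fun j _ => hI j)]
    refine integral_congr_ae (Eventually.of_forall fun x => ?_)
    simp only [EuclideanSpace.real_norm_sq_eq, Finset.sum_mul]
  rw [hsum, Fin.sum_univ_three, integral_coord_sq_mul_eq hf 0 i, integral_coord_sq_mul_eq hf 1 i,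
    integral_coord_sq_mul_eq hf 2 i]
  ring

/-- **The spherical average `1/3`.** For a radial weight `f` on `ℝ³` with `|x|²f ∈ L¹` and every
`k`, `∫ (k·x)² f(x) dx = (|k|²/3) ∫ |x|² f(x) dx`. Applied to `S = v(1 − u)` this is the statement
that the quadratic Taylor term of `Ŝ` at `0` is `−(|k|²/6)∫|x|²S`, i.e. that the `β` used in the
proof of CJL-II Theorem 2 is one third of the printed (betadef) (see `correctedDecayCoeff`). [folklore] -/
theorem integral_inner_sq_mul_eq_of_radial {f : Space → ℝ}
    (hf : ∀ ⦃x y : Space⦄, ‖x‖ = ‖y‖ → f x = f y) (hint : Integrable fun x => ‖x‖ ^ 2 * f x)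
    (hfm : AEStronglyMeasurable f volume) (k : Space) :
    ∫ x : Space, (inner ℝ k x) ^ 2 * f x = ‖k‖ ^ 2 / 3 * ∫ x, ‖x‖ ^ 2 * f x := by
  -- expand `(k·x)² f = ∑ᵢ∑ⱼ kᵢkⱼ · xᵢxⱼf`
  have hexp : ∀ x : Space, (inner ℝ k x) ^ 2 * f x =
      ∑ i : Fin 3, ∑ j : Fin 3, k i * k j * (x i * x j * f x) := by
    intro x
    have hin : inner ℝ k x = ∑ i : Fin 3, k i * x i := by
      simp only [PiLp.inner_apply, RCLike.inner_apply, conj_trivial]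
      exact Finset.sum_congr rfl fun i _ => mul_comm _ _
    rw [hin, sq, Finset.sum_mul_sum, Finset.sum_mul]
    refine Finset.sum_congr rfl fun i _ => ?_
    rw [Finset.sum_mul]
    exact Finset.sum_congr rfl fun j _ => by ring
  have hIij := integrable_coord_mul_coord_mul hint hfm
  simp_rw [hexp]
  rw [integral_finsetSum _ (fun i _ => integrable_finsetSum _
    (fun j _ => (hIij i j).const_mul (k i * k j)))]
  simp_rw [integral_finsetSum _ (fun j _ => (hIij _ j).const_mul (k _ * k j)), integral_const_mul]
  -- diagonal terms `kᵢ² · (1/3)∫|x|²f`, off-diagonal terms vanish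
  have hterm : ∀ i j : Fin 3, k i * k j * ∫ x : Space, x i * x j * f x =
      if i = j then k i ^ 2 * (1 / 3 * ∫ x, ‖x‖ ^ 2 * f x) else 0 := by
    intro i j
    split_ifs with h
    · subst h
      rw [← integral_coord_sq_mul_eq_third hf hint hfm i, sq]
      congr 1
      exact integral_congr_ae (Eventually.of_forall fun x => by simp [sq])
    · rw [integral_coord_mul_coord_mul_eq_zero hf h, mul_zero]
  simp_rw [hterm, Finset.sum_ite_eq, Finset.mem_univ, if_true]
  rw [← Finset.sum_mul, EuclideanSpace.real_norm_sq_eq k]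
  ring

/-! ### Non-vacuity of the standing hypotheses: a Gaussian test potential -/

/-- `(1 + t²)e^{−t} ≤ 16e^{−t/2}` for `t ≥ 0` (from `1 + t/4 ≤ e^{t/4}`). [folklore] -/
theorem one_add_sq_mul_exp_neg_le {t : ℝ} (ht : 0 ≤ t) :
    (1 + t ^ 2) * Real.exp (-t) ≤ 16 * Real.exp (-(t / 2)) := by
  have h1 : t / 4 + 1 ≤ Real.exp (t / 4) := Real.add_one_le_exp _
  have h0 : 0 ≤ t / 4 + 1 := by linarith
  have h2 : (t / 4 + 1) * (t / 4 + 1) ≤ Real.exp (t / 4) * Real.exp (t / 4) :=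
    mul_self_le_mul_self h0 h1
  have h3 : Real.exp (t / 4) * Real.exp (t / 4) = Real.exp (t / 2) := by
    rw [← Real.exp_add]; ring_nf
  have h4 : 1 + t ^ 2 ≤ 16 * Real.exp (t / 2) := by nlinarith
  have h5 : Real.exp (-t) = Real.exp (-(t / 2)) * Real.exp (-(t / 2)) := by
    rw [← Real.exp_add]; ring_nf
  have h6 : Real.exp (t / 2) * Real.exp (-(t / 2)) = 1 := by
    rw [← Real.exp_add, add_neg_cancel, Real.exp_zero]
  have h7 : 0 ≤ Real.exp (-(t / 2)) := (Real.exp_pos _).le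
  calc (1 + t ^ 2) * Real.exp (-t)
      = (1 + t ^ 2) * Real.exp (-(t / 2)) * Real.exp (-(t / 2)) := by rw [h5, mul_assoc]
    _ ≤ 16 * Real.exp (t / 2) * Real.exp (-(t / 2)) * Real.exp (-(t / 2)) := by
        gcongr
    _ = 16 * Real.exp (-(t / 2)) := by
        rw [mul_assoc 16, h6, mul_one]

/-- The Gaussian `e^{−b|x|²}`, `b > 0`, is integrable on `ℝ³` (its integral is `(π/b)^{3/2} ≠ 0`,
Mathlib `GaussianFourier.integral_rexp_neg_mul_sq_norm`). [folklore] -/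
theorem integrable_exp_neg_mul_sq_norm_space {b : ℝ} (hb : 0 < b) :
    Integrable fun x : Space => Real.exp (-b * ‖x‖ ^ 2) := by
  refine Integrable.of_integral_ne_zero ?_
  rw [GaussianFourier.integral_rexp_neg_mul_sq_norm hb]
  positivity

/-- **The standing hypotheses of CJL-II are satisfiable**: the Gaussian `v(x) = e^{−|x|²}` is a
CJL-II potential (`v ≥ 0` radial, `(1 + |x|⁴)v ∈ L¹ ∩ L²`). [folklore] -/
theorem isWeightedPotential_expNegSqNorm :
    IsWeightedPotential fun x : Space => Real.exp (-‖x‖ ^ 2) where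
  nonneg x := (Real.exp_pos _).le
  radial x y h := by simp only [h]
  integrable := by
    have hmeas : AEStronglyMeasurable
        (fun x : Space => (1 + ‖x‖ ^ 4) * Real.exp (-‖x‖ ^ 2)) volume := by
      refine Continuous.aestronglyMeasurable ?_
      fun_prop
    have hg := (integrable_exp_neg_mul_sq_norm_space (by norm_num : (0 : ℝ) < 1 / 2)).const_mul 16
    refine hg.mono' hmeas (Eventually.of_forall fun x => ?_)
    have ht : 0 ≤ ‖x‖ ^ 2 := by positivity
    have h := one_add_sq_mul_exp_neg_le ht
    rw [Real.norm_of_nonneg (by positivity)]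
    calc (1 + ‖x‖ ^ 4) * Real.exp (-‖x‖ ^ 2)
        = (1 + (‖x‖ ^ 2) ^ 2) * Real.exp (-‖x‖ ^ 2) := by ring
      _ ≤ 16 * Real.exp (-(‖x‖ ^ 2 / 2)) := h
      _ = 16 * Real.exp (-(1 / 2) * ‖x‖ ^ 2) := by ring_nf
  memLp_two := by
    have hmeas : AEStronglyMeasurable
        (fun x : Space => (1 + ‖x‖ ^ 4) * Real.exp (-‖x‖ ^ 2)) volume := by
      refine Continuous.aestronglyMeasurable ?_
      fun_prop
    rw [memLp_two_iff_integrable_sq hmeas]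
    have hmeas2 : AEStronglyMeasurable
        (fun x : Space => ((1 + ‖x‖ ^ 4) * Real.exp (-‖x‖ ^ 2)) ^ 2) volume := by
      refine Continuous.aestronglyMeasurable ?_
      fun_prop
    have hg := (integrable_exp_neg_mul_sq_norm_space (by norm_num : (0 : ℝ) < 1)).const_mul 256
    refine hg.mono' hmeas2 (Eventually.of_forall fun x => ?_)
    have ht : 0 ≤ ‖x‖ ^ 2 := by positivity
    have h := one_add_sq_mul_exp_neg_le ht
    have hL : 0 ≤ (1 + (‖x‖ ^ 2) ^ 2) * Real.exp (-‖x‖ ^ 2) := by positivity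
    have hsq := mul_self_le_mul_self hL h
    have hE : Real.exp (-(‖x‖ ^ 2 / 2)) * Real.exp (-(‖x‖ ^ 2 / 2)) = Real.exp (-1 * ‖x‖ ^ 2) := by
      rw [← Real.exp_add]; ring_nf
    rw [Real.norm_of_nonneg (by positivity)]
    calc ((1 + ‖x‖ ^ 4) * Real.exp (-‖x‖ ^ 2)) ^ 2
        = (1 + (‖x‖ ^ 2) ^ 2) * Real.exp (-‖x‖ ^ 2) * ((1 + (‖x‖ ^ 2) ^ 2) * Real.exp (-‖x‖ ^ 2)) := by
          ring
      _ ≤ 16 * Real.exp (-(‖x‖ ^ 2 / 2)) * (16 * Real.exp (-(‖x‖ ^ 2 / 2))) := hsq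
      _ = 256 * Real.exp (-1 * ‖x‖ ^ 2) := by rw [← hE]; ring

/-- `∫ e^{−|x|²} dx > 0` on `ℝ³`: together with `isWeightedPotential_expNegSqNorm`, the hypotheses
`IsWeightedPotential v ∧ 0 < ∫v` of the CJL-II facts are inhabited. [folklore] -/
theorem integral_expNegSqNorm_pos : 0 < ∫ x : Space, Real.exp (-‖x‖ ^ 2) := by
  have h := GaussianFourier.integral_rexp_neg_mul_sq_norm (V := Space) (b := 1) one_pos
  simp only [neg_mul, one_mul] at h
  rw [h]
  positivity

end LiebSimpleEquation

end Literature.MathematicalPhysics.QuantumManyBody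

end
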